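import Literature.Analysis.FluidPDE.CKNLocalRegularityRRS
import Literature.Analysis.FluidPDE.CKNEpsilonRegularityProofs
import Literature.Analysis.FluidPDE.DistributionalPressurePoisson
import HarnessLib

/-!
# From the first local regularity theorem (RRS form) to Lemarié-Rieusset's Thm. 14.4 at unit
# scale, unit viscosity and solenoidal force

Analysis/FluidPDE file in the decomposition of the named fact
`Literature.Analysis.FluidPDE.lemarieRieusset_epsilon_regularity` (Lemarié-Rieusset 2016,
Thm. 14.4). The accepted `lemarieRieusset_epsilon_regularity_iff_unitScale`
(`CKNEpsilonRegularityProofs`) reduces Thm. 14.4 to `r₀ = 1`; this file proves the case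
`ν = 1`, `div f = 0` of that unit-scale statement (about an arbitrary centre `z₀`) from the
target `RRS2016.theorem15_3_force` of `CKNLocalRegularityRRS` (itself proved there from
`RRS2016.step2_force` and, via `CKNLocalRegularityRRSStep3`, the named fact
`RRS2016.lemma15_12`):

* `IsLRSuitableWeakSolutionOn.isSuitablePair` — the standing hypotheses of §14.3 on a domain
  `Ω ⊇ Q_1(z₀)` together with `div f = 0` give a suitable pair with force on `Q_1(z₀)` in the
  sense of `RRS2016.IsSuitablePair` (Def. 15.2): the classes restrict, the local energy
  inequality and `div u = 0` are tested on fewer functions, and the pressure equation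
  `-Δp = ∂ᵢ∂ⱼ(uᵢuⱼ)` in `𝒟'(Q_1(z₀))` is the accepted weak pressure Poisson equation
  `IsDistributionalNSSolutionOn.integral_hessian_add_pressure_laplacian_eq_zero_of_iterated`
  (`DistributionalPressurePoisson`; Lemarié-Rieusset 2016, (13.19)), with
  `D²φ(u, u) = ⟪u, (u·∇)∇φ⟫` (`inner_fderiv_gradient_apply`).
* `lemarieRieusset_unitScale_nu_one_divFree_of_theorem15_3_force` — for `q > 5/2` there are
  `ε₀, C₀ > 0` such that for `(Ω, f, u, p, G)` satisfying the §14.3 hypotheses with `ν = 1` and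
  `div f = 0`, every `Q_1(z₀) ⊆ Ω` and `0 ≤ λ ≤ ε₀`: `∫∫_{Q_1(z₀)} (|u|³ + |p|^{3/2}) ≤ λ³` and
  `∫∫_{Q_1(z₀)} |f|^q ≤ λ^{2q}` imply `|u| ≤ C₀ λ` a.e. on `Q_{1/2}(z₀)`. (Take `ε₀ = λ³`-threshold
  `min(ε⋆^{1/3}, κ(q)^{3/2})`, `C₀ = c_M`: then `λ³ ≤ ε⋆` and `λ^{2q} ≤ (κ λ^{4/3})^q`; for `λ = 0`
  the hypothesis forces `u = 0` a.e. on `Q_1(z₀)`.)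

What remains for Thm. 14.4 itself (not done here): general viscosity `ν > 0` (the parabolic
rescaling `u ↦ ν⁻¹ u(t₀ + s/ν, x₀ + y)` normalises `ν` but maps `Q_{r₀}` onto a cylinder of
aspect ratio `ν`, to be covered by unit-aspect cylinders) and a non-solenoidal force (absorb
`∇Δ⁻¹ div f` into the pressure).

## References

* P. G. Lemarié-Rieusset, *The Navier–Stokes Problem in the 21st Century*, CRC Press (2016),
  Thm. 14.4 and (13.19). [LemarieRieusset2016]
* J. C. Robinson, J. L. Rodrigo, W. Sadowski, *The three-dimensional Navier–Stokes equations*,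
  CUP (2016), Def. 15.2, Thm. 15.3. [RobinsonRodrigoSadowski2016]
-/

noncomputable section

open MeasureTheory Set Function Filter Topology TopologicalSpace Metric
open scoped NNReal ENNReal InnerProductSpace RealInnerProductSpace Laplacian

namespace Literature.Analysis.FluidPDE

/-- `L^q(Ω)` with `q ≥ 1` on an open set is locally integrable there (Hölder on compact subsets,
which have finite measure). [folklore] -/
private theorem locallyIntegrableOn_of_memLp_restrict' {X F : Type*} [MeasurableSpace X]
    [TopologicalSpace X] [OpensMeasurableSpace X] [T2Space X] [LocallyCompactSpace X]
    {μ : Measure X}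
    [IsFiniteMeasureOnCompacts μ] [NormedAddCommGroup F] {Ω : Opens X} {g : X → F} {q : ℝ}
    (hg : MemLp g (ENNReal.ofReal q) (μ.restrict (Ω : Set X))) (hq : 1 ≤ q) :
    LocallyIntegrableOn g (Ω : Set X) μ := by
  rw [locallyIntegrableOn_iff Ω.isOpen.isLocallyClosed]
  intro K hK hKc
  have h1 : MemLp g (ENNReal.ofReal q) (μ.restrict K) :=
    hg.mono_measure (Measure.restrict_mono hK le_rfl)
  haveI : IsFiniteMeasure (μ.restrict K) := isFiniteMeasure_restrict.2 hKc.measure_lt_top.ne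
  have h2 : MemLp g 1 (μ.restrict K) :=
    h1.mono_exponent (by rw [← ENNReal.ofReal_one]; exact ENNReal.ofReal_le_ofReal hq)
  exact memLp_one_iff_integrable.1 h2

variable {Ω : Opens (ℝ × EuclideanSpace ℝ (Fin 3))} {ν q : ℝ}
  {f u : ℝ → EuclideanSpace ℝ (Fin 3) → EuclideanSpace ℝ (Fin 3)}
  {p : ℝ → EuclideanSpace ℝ (Fin 3) → ℝ}
  {G : ℝ → EuclideanSpace ℝ (Fin 3) → EuclideanSpace ℝ (Fin 3) →L[ℝ] EuclideanSpace ℝ (Fin 3)}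

/-- **The §14.3 hypotheses with `div f = 0` give a suitable pair on every unit cylinder
`Q_1(z₀) ⊆ Ω`.** The classes `u ∈ L^∞_t L²_x`, `∇u ∈ L²`, `p ∈ L^{3/2}` restrict from `Ω`; `div u = 0`
and the local energy inequality (14.16) are tested on `𝒟(Q_1(z₀)) ⊆ 𝒟(Ω)`; and the pressure
equation `-Δp = ∂ᵢ∂ⱼ(uᵢuⱼ)` in `𝒟'(Q_1(z₀))` follows from the Navier–Stokes system and
`div u = div f = 0` (Lemarié-Rieusset 2016, (13.19); the accepted
`IsDistributionalNSSolutionOn.integral_hessian_add_pressure_laplacian_eq_zero_of_iterated`). [cite: LemarieRieusset2016, (13.19) p. 461 and Thm. 14.4] -/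
theorem IsLRSuitableWeakSolutionOn.isSuitablePair (hS : IsLRSuitableWeakSolutionOn Ω ν q f u p G)
    (hq : 1 ≤ q)
    (hdivf : ∀ φ : ℝ → EuclideanSpace ℝ (Fin 3) → ℝ, IsSpaceTimeTestOn Ω φ →
      ∫ t, ∫ x, ⟪f t x, gradient (φ t) x⟫ = 0)
    {z₀ : ℝ × EuclideanSpace ℝ (Fin 3)}
    (hsub : parabolicCylinder 1 z₀ ⊆ (Ω : Set (ℝ × EuclideanSpace ℝ (Fin 3)))) :
    RRS2016.IsSuitablePair (parabolicCylinderOpens 1 z₀) ν f u p G := by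
  have hle : parabolicCylinderOpens 1 z₀ ≤ Ω := hsub
  have hns := hS.distributional.of_le hle
  have hf₁ : LocallyIntegrableOn (uncurry f)
      ((parabolicCylinderOpens 1 z₀ : Opens _) : Set (ℝ × EuclideanSpace ℝ (Fin 3))) volume :=
    (locallyIntegrableOn_of_memLp_restrict' hS.force_memLp hq).mono_set hsub
  refine
    { energy := ?_
      sq_locallyIntegrableOn := hns.2.1
      weakGradient := hS.weakGradient.mono hle
      gradient_lt_top := (lintegral_mono_set hsub).trans_lt hS.gradient_lt_top
      pressure_locallyIntegrableOn := hns.2.2.1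
      pressure_lt_top := (lintegral_mono_set hsub).trans_lt hS.pressure_lt_top
      divFree := hns.2.2.2.1
      pressureEq := fun φ hφ => ?_
      localEnergy := fun φ hφ hφ0 => hS.localEnergy φ (hφ.mono hle) hφ0 }
  · obtain ⟨C, hC⟩ := hS.energyClass
    refine ⟨C, ?_⟩
    filter_upwards [hC] with t ht
    refine (lintegral_mono fun x => ?_).trans ht
    exact indicator_le_indicator_of_subset hsub (fun _ => zero_le) _
  · have key := hns.integral_hessian_add_pressure_laplacian_eq_zero_of_iterated hf₁
      (fun θ hθ => hdivf θ (hθ.mono hle)) hφ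
    have hφ2 : ∀ t, ContDiff ℝ 2 (φ t) := fun t => contDiff_infty.1 (hφ.contDiff_slice t) 2
    rw [← key]
    refine setIntegral_congr_fun (isOpen_parabolicCylinder 1 z₀).measurableSet fun w _ => ?_
    rw [convect, inner_fderiv_gradient_apply (hφ2 w.1)]

/-- **Lemarié-Rieusset's Thm. 14.4 at unit scale, for `ν = 1` and a solenoidal force, from the
first local regularity theorem with force.** For `q > 5/2` there are `ε₀, C₀ > 0` such that
for every `(Ω, f, u, p, G)` satisfying the §14.3 hypotheses (`IsLRSuitableWeakSolutionOn`) with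
`ν = 1`, `div f = 0` in `𝒟'(Ω)`, every unit cylinder `Q_1(z₀) ⊆ Ω` and `0 ≤ λ ≤ ε₀`:
`∫∫_{Q_1(z₀)} (|u|³ + |p|^{3/2}) ≤ λ³` and `∫∫_{Q_1(z₀)} |f|^q ≤ λ^{2q}` imply `|u| ≤ C₀ λ` a.e. on
`Q_{1/2}(z₀)`. [cite: LemarieRieusset2016, Thm. 14.4 p. 505] -/
theorem lemarieRieusset_unitScale_nu_one_divFree_of_theorem15_3_force
    (h : RRS2016.theorem15_3_force) {q : ℝ} (hq : 5 / 2 < q) :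
    ∃ ε₀ C₀ : ℝ, 0 < ε₀ ∧ 0 < C₀ ∧
      ∀ (Ω : Opens (ℝ × EuclideanSpace ℝ (Fin 3)))
        (f u : ℝ → EuclideanSpace ℝ (Fin 3) → EuclideanSpace ℝ (Fin 3))
        (p : ℝ → EuclideanSpace ℝ (Fin 3) → ℝ)
        (G : ℝ → EuclideanSpace ℝ (Fin 3) → EuclideanSpace ℝ (Fin 3) →L[ℝ] EuclideanSpace ℝ (Fin 3)),
        IsLRSuitableWeakSolutionOn Ω 1 q f u p G →
        (∀ φ : ℝ → EuclideanSpace ℝ (Fin 3) → ℝ, IsSpaceTimeTestOn Ω φ →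
          ∫ t, ∫ x, ⟪f t x, gradient (φ t) x⟫ = 0) →
        ∀ (z₀ : ℝ × EuclideanSpace ℝ (Fin 3)) (l : ℝ),
          parabolicCylinder 1 z₀ ⊆ (Ω : Set (ℝ × EuclideanSpace ℝ (Fin 3))) → 0 ≤ l → l ≤ ε₀ →
          ∫⁻ w in parabolicCylinder 1 z₀,
              (‖u w.1 w.2‖ₑ ^ (3 : ℕ) + ‖p w.1 w.2‖ₑ ^ (3 / 2 : ℝ)) ≤ ENNReal.ofReal (l ^ 3) →
          ∫⁻ w in parabolicCylinder 1 z₀, ‖f w.1 w.2‖ₑ ^ q ≤ ENNReal.ofReal (l ^ (2 * q)) →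
          ∀ᵐ w ∂(volume.restrict (parabolicCylinder (1 / 2) z₀)), ‖u w.1 w.2‖ ≤ C₀ * l := by
  obtain ⟨ε₁, cM, hε₁, hcM, H⟩ := h
  obtain ⟨κ, hκ, Hq⟩ := H q hq
  have hq0 : 0 < q := by linarith
  have hq1 : 1 ≤ q := by linarith
  refine ⟨min (ε₁ ^ (1 / 3 : ℝ)) (κ ^ (3 / 2 : ℝ)), cM, lt_min (Real.rpow_pos_of_pos hε₁ _)
    (Real.rpow_pos_of_pos hκ _), hcM, ?_⟩
  intro Ω f u p G hS hdivf z₀ l hsub hl0 hlε hsmall hforce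
  have hP := hS.isSuitablePair hq1 hdivf hsub
  have hfq : MemLp (uncurry f) (ENNReal.ofReal q) (volume.restrict (parabolicCylinder 1 z₀)) :=
    hS.force_memLp.mono_measure (Measure.restrict_mono hsub le_rfl)
  rcases hl0.lt_or_eq with hl | hl
  · -- `λ > 0`: apply the theorem with `ε₀ = λ³`
    have hl3 : 0 < l ^ 3 := pow_pos hl 3
    have hle1 : l ^ 3 ≤ ε₁ := by
      have h1 : l ≤ ε₁ ^ (1 / 3 : ℝ) := hlε.trans (min_le_left _ _)
      calc l ^ 3 ≤ (ε₁ ^ (1 / 3 : ℝ)) ^ 3 := pow_le_pow_left₀ hl0 h1 3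
        _ = ε₁ := by rw [← Real.rpow_natCast, ← Real.rpow_mul hε₁.le]; norm_num
    have hsmall' : RRS2016.Small (l ^ 3) u p z₀ := hsmall
    have hforce' : ∫⁻ w in parabolicCylinder 1 z₀, ‖f w.1 w.2‖ₑ ^ q ≤
        ENNReal.ofReal ((κ * (l ^ 3) ^ (4 / 9 : ℝ)) ^ q) := by
      refine hforce.trans (ENNReal.ofReal_le_ofReal ?_)
      have h2 : l ≤ κ ^ (3 / 2 : ℝ) := hlε.trans (min_le_right _ _)
      have h3 : l ^ (2 / 3 : ℝ) ≤ κ := by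
        calc l ^ (2 / 3 : ℝ) ≤ (κ ^ (3 / 2 : ℝ)) ^ (2 / 3 : ℝ) :=
              Real.rpow_le_rpow hl0 h2 (by norm_num)
          _ = κ := by rw [← Real.rpow_mul hκ.le]; norm_num
      have h4 : (l ^ 3) ^ (4 / 9 : ℝ) = l ^ (4 / 3 : ℝ) := by
        rw [← Real.rpow_natCast, ← Real.rpow_mul hl0]; norm_num
      have h5 : l ^ (2 * q) = (l ^ (2 : ℝ)) ^ q := by
        rw [← Real.rpow_mul hl0]
      have h6 : l ^ (2 : ℝ) ≤ κ * l ^ (4 / 3 : ℝ) := by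
        have : l ^ (2 : ℝ) = l ^ (2 / 3 : ℝ) * l ^ (4 / 3 : ℝ) := by
          rw [← Real.rpow_add hl]; norm_num
        rw [this]
        exact mul_le_mul_of_nonneg_right h3 (Real.rpow_nonneg hl0 _)
      rw [h4, h5]
      exact Real.rpow_le_rpow (Real.rpow_nonneg hl0 _) h6 hq0.le
    have key := Hq z₀ f u p G hP hfq (l ^ 3) hl3 hle1 hsmall' hforce'
    have hl13 : (l ^ 3) ^ (1 / 3 : ℝ) = l := by
      rw [← Real.rpow_natCast, ← Real.rpow_mul hl0]; norm_num
    simpa only [hl13] using key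
  · -- `λ = 0`: `u = 0` a.e. on `Q_1(z₀)`
    subst hl
    have hu : AEStronglyMeasurable (uncurry u) (volume.restrict (parabolicCylinder 1 z₀)) :=
      hP.weakGradient.locallyIntegrableOn.aestronglyMeasurable
    have h0 : ∫⁻ w in parabolicCylinder 1 z₀, ‖u w.1 w.2‖ₑ ^ (3 : ℕ) = 0 := by
      refine le_antisymm ?_ (zero_le)
      calc ∫⁻ w in parabolicCylinder 1 z₀, ‖u w.1 w.2‖ₑ ^ (3 : ℕ)
          ≤ ∫⁻ w in parabolicCylinder 1 z₀, (‖u w.1 w.2‖ₑ ^ (3 : ℕ) + ‖p w.1 w.2‖ₑ ^ (3 / 2 : ℝ)) :=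
            lintegral_mono fun w => le_self_add
        _ ≤ ENNReal.ofReal ((0 : ℝ) ^ 3) := hsmall
        _ = 0 := by norm_num
    have hae : ∀ᵐ w ∂(volume.restrict (parabolicCylinder 1 z₀)), ‖u w.1 w.2‖ₑ ^ (3 : ℕ) = 0 :=
      (lintegral_eq_zero_iff' (hu.enorm.pow_const _)).1 h0
    have hae' : ∀ᵐ w ∂(volume.restrict (parabolicCylinder (1 / 2) z₀)), ‖u w.1 w.2‖ₑ ^ (3 : ℕ) = 0 :=
      ae_restrict_of_ae_restrict_of_subset (parabolicCylinder_mono (by norm_num) (by norm_num) z₀) hae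
    filter_upwards [hae'] with w hw
    have : ‖u w.1 w.2‖ₑ = 0 := by
      by_contra hne
      exact absurd hw (pow_ne_zero 3 hne)
    rw [enorm_eq_zero] at this
    rw [this, norm_zero, mul_zero]

end Literature.Analysis.FluidPDE
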